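import Mathlib
import Literature.NumberTheory.LFunctions.RHWave0PNTProofs
import Literature.NumberTheory.LFunctions.ChebyshevSylvesterPrimeWindows
import HarnessLib

/-!
# Teräväinen 2024, §5.2 (deduction of Theorem 2.6 from Propositions 5.3–5.4): generic tools

Support file (everything PROVED; no definitions, no named facts) towards the named fact
`Literature.NumberTheory.Sieve.teravainen2024_cor_2_1` (J. Teräväinen, *On the Liouville function
at polynomial arguments*, Amer. J. Math. 146 (2024) = arXiv:2010.07924, Corollary 2.1 ⊂
Theorem 2.6 for `g_j = λ`, proved in §5). The deduction of (5.13) from Propositions 5.3 and 5.4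
(p. 11, "Proof of Theorem 2.6 assuming Propositions 5.3 and 5.4") uses three generic devices,
proved here:

* `Teravainen2024.exists_prime_Ioc_one_add_mul` — "let `N ∈ [(1+εM)P, (1+2εM)P]` be a prime;
  such a prime exists by the prime number theorem": for every `ε > 0` and all large `y` there is
  a prime in `(y, (1+ε)y]` (from the tree's PNT `ϑ(x) ∼ x`,
  `Literature.NumberTheory.LFunctions.chebyshevTheta_isEquivalent`);
* `Teravainen2024.norm_sum_Icc_le_avg_windows` — "We split the `n` average into intervals of
  length `P`": `‖∑_{n≤x} G(n)‖ ≤ P⁻¹ ∑_{x''<x} ‖∑_{m≤P} G(x''+m)‖ + 2P` for `1`-bounded `G`;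
* `Teravainen2024.sum_le_of_card_exceptional_le` — "apart from `≤ ηX` exceptions … this gives the
  desired bound": an average of `[0,1]`-valued quantities that are `≤ 1-η` off an exceptional set
  of density `κ` is `≤ 1 - η + κ`.

## References
* J. Teräväinen, Amer. J. Math. 146 (2024), §5.2, p. 11 (arXiv:2010.07924). [Teravainen2024]
* H. L. Montgomery, R. C. Vaughan, *Multiplicative Number Theory I*, §8.1 (8.3) (PNT for `ϑ`).
  [MontgomeryVaughan2007]
-/

noncomputable section

open Finset Complex Filter Asymptotics
open scoped Chebyshev

namespace Literature.NumberTheory.Sieve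

namespace Teravainen2024

open Literature.NumberTheory.LFunctions

/-! ### Primes in `(y, (1+ε) y]` -/

/-- **Primes in short ratio intervals** (PNT): for `0 < ε ≤ 1` there is `y₀` such that every
`y ≥ y₀` has a prime in `(y, (1+ε)y]`. [cite: MontgomeryVaughan2007, §8.1 (8.3) (consequence)] -/
theorem exists_prime_Ioc_one_add_mul {ε : ℝ} (hε0 : 0 < ε) (hε1 : ε ≤ 1) :
    ∃ y₀ : ℝ, ∀ y : ℝ, y₀ ≤ y → ∃ p : ℕ, p.Prime ∧ y < p ∧ (p : ℝ) ≤ (1 + ε) * y := by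
  have hθ := (chebyshevTheta_isEquivalent).isLittleO
  have hc : (0 : ℝ) < ε / 4 := by positivity
  have hev : ∀ᶠ x : ℝ in atTop, ‖(Chebyshev.theta - fun x : ℝ => x) x‖ ≤ ε / 4 * ‖x‖ := hθ.def hc
  obtain ⟨y₁, hy₁⟩ := Filter.eventually_atTop.mp hev
  refine ⟨max y₁ 1, fun y hy => ?_⟩
  have hy1 : 1 ≤ y := le_trans (le_max_right _ _) hy
  have hyy₁ : y₁ ≤ y := le_trans (le_max_left _ _) hy
  have hy0 : 0 < y := by linarith
  -- `θ(y) ≤ (1 + ε/4) y` and `θ((1+ε)y) ≥ (1 - ε/4)(1+ε) y`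
  have h1 := hy₁ y hyy₁
  have h2 := hy₁ ((1 + ε) * y) (by nlinarith)
  simp only [Pi.sub_apply, Real.norm_eq_abs] at h1 h2
  rw [abs_of_pos hy0] at h1
  rw [abs_of_pos (by positivity : (0 : ℝ) < (1 + ε) * y)] at h2
  have hlt : θ y < θ ((1 + ε) * y) := by
    have e1 : θ y ≤ y + ε / 4 * y := by linarith [(abs_le.mp h1).2]
    have e2 : (1 + ε) * y - ε / 4 * ((1 + ε) * y) ≤ θ ((1 + ε) * y) := by linarith [(abs_le.mp h2).1]
    have e3 : (1 + ε) * y - ε / 4 * ((1 + ε) * y) = y + ε * y - ε * y / 4 - ε ^ 2 * y / 4 := by ring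
    have hεy : 0 < ε * y := mul_pos hε0 hy0
    have key : ε * y / 4 + ε ^ 2 * y / 4 < ε * y - ε * y / 4 := by nlinarith
    rw [e3] at e2
    linarith
  exact Sylvester.exists_prime_of_theta_lt hy0.le (by nlinarith) hlt

/-! ### Splitting a long average into windows -/

/-- **Windows.** For a `1`-bounded `G` and `1 ≤ P`:
`‖∑_{1≤n≤x} G(n)‖ ≤ P⁻¹ ∑_{x''<x} ‖∑_{1≤m≤P} G(x''+m)‖ + 2P`.
[cite: Teravainen2024, §5.2, p. 11 ("We split the n average … into intervals of length P")] -/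
theorem norm_sum_Icc_le_avg_windows {G : ℕ → ℂ} (hG : ∀ n, ‖G n‖ ≤ 1) {P : ℕ} (hP : 1 ≤ P)
    (x : ℕ) :
    ‖∑ n ∈ Finset.Icc 1 x, G n‖ ≤
      (1 / P : ℝ) * ∑ x'' ∈ Finset.range x, ‖∑ m ∈ Finset.Icc 1 P, G (x'' + m)‖ + 2 * P := by
  have hPR : (0 : ℝ) < P := by exact_mod_cast hP
  -- the double sum, summed the other way
  have hswap : ∑ x'' ∈ Finset.range x, ∑ m ∈ Finset.Icc 1 P, G (x'' + m) =
      ∑ m ∈ Finset.Icc 1 P, ∑ n ∈ Finset.Ico m (x + m), G n := by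
    rw [Finset.sum_comm]
    refine Finset.sum_congr rfl fun m _ => ?_
    rw [Finset.range_eq_Ico, Finset.sum_Ico_add' G 0 x m, zero_add]
  -- each inner sum differs from `∑_{1≤n≤x} G` by at most `2P`
  have hdiff : ∀ m ∈ Finset.Icc 1 P, ‖∑ n ∈ Finset.Ico m (x + m), G n - ∑ n ∈ Finset.Icc 1 x, G n‖ ≤ 2 * P := by
    intro m hm
    rw [Finset.mem_Icc] at hm
    -- write both over `Ico`: `Icc 1 x = Ico 1 (x+1)`
    have e1 : Finset.Icc 1 x = Finset.Ico 1 (x + 1) := by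
      ext n
      simp only [Finset.mem_Icc, Finset.mem_Ico]
      omega
    rw [e1]
    -- `Ico m (x+m) = Ico m (x+1) ∪ Ico (x+1) (x+m)` and `Ico 1 (x+1) = Ico 1 m ∪ Ico m (x+1)` when `m ≤ x+1`
    rcases le_or_gt m (x + 1) with hmx | hmx
    · rw [← Finset.sum_Ico_consecutive G hmx (by omega : x + 1 ≤ x + m),
        ← Finset.sum_Ico_consecutive G hm.1 hmx]
      have : ∑ n ∈ Finset.Ico m (x + 1), G n + ∑ n ∈ Finset.Ico (x + 1) (x + m), G n -
          (∑ n ∈ Finset.Ico 1 m, G n + ∑ n ∈ Finset.Ico m (x + 1), G n) =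
          ∑ n ∈ Finset.Ico (x + 1) (x + m), G n - ∑ n ∈ Finset.Ico 1 m, G n := by ring
      rw [this]
      refine (norm_sub_le _ _).trans ?_
      have b1 : ‖∑ n ∈ Finset.Ico (x + 1) (x + m), G n‖ ≤ P := by
        refine (norm_sum_le _ _).trans ?_
        calc ∑ n ∈ Finset.Ico (x + 1) (x + m), ‖G n‖ ≤ ∑ _n ∈ Finset.Ico (x + 1) (x + m), (1 : ℝ) :=
              Finset.sum_le_sum fun n _ => hG n
          _ = ((x + m - (x + 1) : ℕ) : ℝ) := by simp
          _ ≤ P := by exact_mod_cast (by omega : x + m - (x + 1) ≤ P)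
      have b2 : ‖∑ n ∈ Finset.Ico 1 m, G n‖ ≤ P := by
        refine (norm_sum_le _ _).trans ?_
        calc ∑ n ∈ Finset.Ico 1 m, ‖G n‖ ≤ ∑ _n ∈ Finset.Ico 1 m, (1 : ℝ) :=
              Finset.sum_le_sum fun n _ => hG n
          _ = ((m - 1 : ℕ) : ℝ) := by simp
          _ ≤ P := by exact_mod_cast (by omega : m - 1 ≤ P)
      linarith
    · -- `m > x + 1`: both sums are short
      have b1 : ‖∑ n ∈ Finset.Ico m (x + m), G n‖ ≤ P := by
        refine (norm_sum_le _ _).trans ?_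
        calc ∑ n ∈ Finset.Ico m (x + m), ‖G n‖ ≤ ∑ _n ∈ Finset.Ico m (x + m), (1 : ℝ) :=
              Finset.sum_le_sum fun n _ => hG n
          _ = ((x + m - m : ℕ) : ℝ) := by simp
          _ ≤ P := by exact_mod_cast (by omega : x + m - m ≤ P)
      have b2 : ‖∑ n ∈ Finset.Ico 1 (x + 1), G n‖ ≤ P := by
        refine (norm_sum_le _ _).trans ?_
        calc ∑ n ∈ Finset.Ico 1 (x + 1), ‖G n‖ ≤ ∑ _n ∈ Finset.Ico 1 (x + 1), (1 : ℝ) :=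
              Finset.sum_le_sum fun n _ => hG n
          _ = ((x + 1 - 1 : ℕ) : ℝ) := by simp
          _ ≤ P := by exact_mod_cast (by omega : x + 1 - 1 ≤ P)
      exact (norm_sub_le _ _).trans (by linarith)
  -- `P · ∑_{n≤x} G = ∑∑ - ∑_m (inner - total)`
  have hkey : (P : ℂ) * ∑ n ∈ Finset.Icc 1 x, G n =
      ∑ x'' ∈ Finset.range x, ∑ m ∈ Finset.Icc 1 P, G (x'' + m) -
        ∑ m ∈ Finset.Icc 1 P, (∑ n ∈ Finset.Ico m (x + m), G n - ∑ n ∈ Finset.Icc 1 x, G n) := by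
    rw [hswap, Finset.sum_sub_distrib, sub_sub_cancel, Finset.sum_const, Nat.card_Icc,
      Nat.add_sub_cancel, nsmul_eq_mul]
  have hnorm : (P : ℝ) * ‖∑ n ∈ Finset.Icc 1 x, G n‖ ≤
      ∑ x'' ∈ Finset.range x, ‖∑ m ∈ Finset.Icc 1 P, G (x'' + m)‖ + 2 * P * P := by
    have h1 : (P : ℝ) * ‖∑ n ∈ Finset.Icc 1 x, G n‖ = ‖(P : ℂ) * ∑ n ∈ Finset.Icc 1 x, G n‖ := by
      rw [norm_mul, Complex.norm_natCast]
    rw [h1, hkey]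
    refine (norm_sub_le _ _).trans (add_le_add (norm_sum_le _ _) ?_)
    refine (norm_sum_le _ _).trans ?_
    calc ∑ m ∈ Finset.Icc 1 P, ‖∑ n ∈ Finset.Ico m (x + m), G n - ∑ n ∈ Finset.Icc 1 x, G n‖
        ≤ ∑ _m ∈ Finset.Icc 1 P, (2 * P : ℝ) := Finset.sum_le_sum hdiff
      _ = 2 * P * P := by rw [Finset.sum_const, Nat.card_Icc, Nat.add_sub_cancel, nsmul_eq_mul]; ring
  rw [one_div, inv_mul_eq_div, div_add' _ _ _ hPR.ne', le_div_iff₀ hPR]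
  linarith

/-! ### Averages with an exceptional set -/

/-- **Exceptional sets.** If `a(i) ≤ 1` on a finite set `S` and `a(i) ≤ 1 - η` outside an
exceptional subset of size `≤ κ #S`, then `∑_{i∈S} a(i) ≤ (1 - η + κ) #S` (for `0 ≤ η ≤ 1`).
[cite: Teravainen2024, §5.2, p. 11 (end of the deduction: "apart from ≤ ηX exceptions")] -/
theorem sum_le_of_card_exceptional_le {ι : Type*} (S : Finset ι) {a : ι → ℝ} {η κ : ℝ}
    (hη0 : 0 ≤ η) (hη1 : η ≤ 1) (ha1 : ∀ i ∈ S, a i ≤ 1)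
    [DecidablePred fun i => 1 - η < a i]
    (hexc : (#(S.filter fun i => 1 - η < a i) : ℝ) ≤ κ * #S) :
    ∑ i ∈ S, a i ≤ (1 - η + κ) * #S := by
  classical
  rw [← Finset.sum_filter_add_sum_filter_not S (fun i => 1 - η < a i)]
  have h1 : ∑ i ∈ S.filter (fun i => 1 - η < a i), a i ≤ #(S.filter fun i => 1 - η < a i) := by
    calc ∑ i ∈ S.filter (fun i => 1 - η < a i), a i ≤ ∑ _i ∈ S.filter (fun i => 1 - η < a i), (1 : ℝ) :=
          Finset.sum_le_sum fun i hi => ha1 i (Finset.mem_filter.mp hi).1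
      _ = _ := by simp
  have h2 : ∑ i ∈ S.filter (fun i => ¬ 1 - η < a i), a i ≤ (1 - η) * #(S.filter fun i => ¬ 1 - η < a i) := by
    calc ∑ i ∈ S.filter (fun i => ¬ 1 - η < a i), a i
        ≤ ∑ _i ∈ S.filter (fun i => ¬ 1 - η < a i), (1 - η) :=
          Finset.sum_le_sum fun i hi => not_lt.mp (Finset.mem_filter.mp hi).2
      _ = _ := by rw [Finset.sum_const, nsmul_eq_mul, mul_comm]
  have hcard : (#(S.filter fun i => 1 - η < a i) : ℝ) + #(S.filter fun i => ¬ 1 - η < a i) = #S := by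
    exact_mod_cast Finset.card_filter_add_card_filter_not (s := S) (fun i => 1 - η < a i)
  have hB0 : (0 : ℝ) ≤ #(S.filter fun i => 1 - η < a i) := by positivity
  nlinarith

end Teravainen2024

end Literature.NumberTheory.Sieve
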